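import Summits.CriticalPhenomena.CardyFormulaZ2.Theorems.CardySelfDualSegmentUniformMarginalityDefs2

/-!
# Sub-goal (HF) `stub_heatFlowBalance` of line `Sketch` for the crux `UniformMarginality`
(stmt-CriticalPhenomena-5472): the one-corner heat-flow balances
`E_t[𝟙{N_v piv}(1 − 2·𝟙_A)] = (1 − t) E_t[(1 − 2c_v)𝟙{N_v piv}]` and its east twin
`E_t[𝟙{E_v piv}(1 − 2·𝟙_A)] = (1 − t) E_t[(1 − 2n_v)𝟙{E_v piv}]`, for every vertex `v`,
every mesh and every `t ∈ (0,1)` (`A = crossEvent R δ`, `c_v = 𝟙{E_v open}`, `n_v = 𝟙{N_v open}`).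

Proof. On `{e pivotal}` the increasing event `A` holds iff `e` is open (`pivotal_mul_sign_eq`),
so both sides are integrals of `(1 − 2·𝟙{f open}) 𝟙{e pivotal}` (`f = e` on the left, `f` = the
other edge of the corner on the right), i.e. signed combinations `μ(G) − 2 μ(G ∩ F_f)` of
probabilities (`integral_sign_mul_pivotal`). Pull back to the coin space through the coding `φ`
(`cornerConfig` for the north half; for the east half the transposed coding
`cornerConfig ∘ blockMap transposeBit`, which has the same law `M_t` (`map_cornerConfigT_eq`) and
exchanges the roles of the two edges of the corner): the pivotality event `G = φ⁻¹{e piv}` and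
the "other edge" event `C = φ⁻¹{f open} = {c_v = 1}` do not depend on the splitting bit `d_v`,
while `φ⁻¹{e open} = {c_v ≠ d_v} = C XOR {d_v = 1}`. Integrating out the independent bit
`d_v ~ Ber(t/2)` (`prodBernoulli_real_inter_xor`, from `prodBernoulli_real_inter_of_determinedBy`):
`μ(G) − 2μ(G ∩ {c_v ≠ d_v}) = (1 − t)(μ(G) − 2μ(G ∩ C))` (`balance_abstract`).
-/

namespace Summit.CriticalPhenomena.CardyFormulaZ2.Cruxes.UniformMarginality.HeatFlow

open MeasureTheory Literature.Probability.Percolation Literature.Probability.LatticeModels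
  Literature.Probability.RandomPlanarGeometry
open scoped Classical

/-! ## §1 Integrating out one coordinate of `prodBernoulli` -/

section Generic

variable {ι : Type*}

/-- The coordinate event `{S | i ∈ S}` is determined by `{i}`. -/
private theorem determinedBy_setOf_mem' (i : ι) :
    DeterminedBy {S : Set ι | i ∈ S} ({i} : Set ι) := by
  rw [determinedBy_iff]
  intro ω ω' h
  have := Set.ext_iff.1 h i
  simpa only [Set.mem_inter_iff, Set.mem_singleton_iff, and_true, Set.mem_setOf_eq] using this

/-- **Integrating out one coordinate.** If `G` and `C` are measurable events not depending on
the coordinate `i`, then for the event `C XOR (i ∈ S)`,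
`μ(G ∩ (C XOR i)) = (1 − p_i) μ(G ∩ C) + p_i (μ G − μ(G ∩ C))`. -/
private theorem prodBernoulli_real_inter_xor (p : ι → unitInterval) (i : ι) {G C : Set (Set ι)}
    (hG : DeterminedBy G ({i}ᶜ : Set ι)) (hC : DeterminedBy C ({i}ᶜ : Set ι))
    (hGm : MeasurableSet G) (hCm : MeasurableSet C) :
    (prodBernoulli p).real (G ∩ {S | S ∈ C ↔ i ∉ S}) =
      (1 - (p i : ℝ)) * (prodBernoulli p).real (G ∩ C) +
        (p i : ℝ) * ((prodBernoulli p).real G - (prodBernoulli p).real (G ∩ C)) := by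
  -- split along the state of `i`
  have hsplit : G ∩ {S | S ∈ C ↔ i ∉ S} =
      ({S | i ∉ S} ∩ (G ∩ C)) ∪ ({S | i ∈ S} ∩ (G \ C)) := by
    ext S
    simp only [Set.mem_inter_iff, Set.mem_setOf_eq, Set.mem_union, Set.mem_sdiff]
    tauto
  have hdisj : Disjoint ({S : Set ι | i ∉ S} ∩ (G ∩ C)) ({S | i ∈ S} ∩ (G \ C)) := by
    rw [Set.disjoint_left]
    rintro S ⟨hS, -⟩ ⟨hS', -⟩
    exact hS hS'
  have hF : (↑({i} : Finset ι) : Set ι) = {i} := Finset.coe_singleton i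
  have h1 : (prodBernoulli p).real ({S : Set ι | i ∉ S} ∩ (G ∩ C)) =
      (1 - (p i : ℝ)) * (prodBernoulli p).real (G ∩ C) := by
    rw [prodBernoulli_real_inter_of_determinedBy p {i}
      (by rw [hF]; exact (determinedBy_setOf_mem' i).compl) (by rw [hF]; exact hG.inter hC)
      (measurableSet_notMem i) (hGm.inter hCm),
      prodBernoulli_real_setOf_notMem]
  have h2 : (prodBernoulli p).real ({S : Set ι | i ∈ S} ∩ (G \ C)) =
      (p i : ℝ) * ((prodBernoulli p).real G - (prodBernoulli p).real (G ∩ C)) := by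
    rw [prodBernoulli_real_inter_of_determinedBy p {i} (by rw [hF]; exact determinedBy_setOf_mem' i)
      (by rw [hF, Set.sdiff_eq]; exact hG.inter hC.compl) (measurableSet_mem i) (hGm.diff hCm),
      prodBernoulli_real_setOf_mem]
    congr 1
    have := measureReal_inter_add_sdiff (μ := prodBernoulli p) (s := G) hCm
    linarith
  rw [hsplit, measureReal_union hdisj ((measurableSet_mem i).inter (hGm.diff hCm)), h1, h2]

/-- **Abstract heat-flow balance**: under the hypotheses of `prodBernoulli_real_inter_xor`,
`μ G − 2 μ(G ∩ (C XOR i)) = (1 − 2 p_i) (μ G − 2 μ(G ∩ C))`. -/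
private theorem balance_abstract (p : ι → unitInterval) (i : ι) {G C : Set (Set ι)}
    (hG : DeterminedBy G ({i}ᶜ : Set ι)) (hC : DeterminedBy C ({i}ᶜ : Set ι))
    (hGm : MeasurableSet G) (hCm : MeasurableSet C) :
    (prodBernoulli p).real G - 2 * (prodBernoulli p).real (G ∩ {S | S ∈ C ↔ i ∉ S}) =
      (1 - 2 * (p i : ℝ)) *
        ((prodBernoulli p).real G - 2 * (prodBernoulli p).real (G ∩ C)) := by
  rw [prodBernoulli_real_inter_xor p i hG hC hGm hCm]
  ring

end Generic

/-! ## §2 Pivotality on configuration spaces `Set α` -/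

section SetSpace

variable {α : Type*}

/-- Switching a coordinate on is measurable. -/
private theorem measurable_insert' (a : α) : Measurable (insert a : Set α → Set α) :=
  measurable_set_iff.2 fun x => by
    simp only [Set.mem_insert_iff]
    exact measurable_const.or (measurable_set_mem x)

/-- Switching a coordinate off is measurable. -/
private theorem measurable_sdiff_singleton' (a : α) : Measurable (· \ {a} : Set α → Set α) :=
  measurable_set_iff.2 fun x => (measurable_set_mem x).and measurable_const

/-- The pivotality event of a measurable event is measurable. -/
private theorem measurableSet_isPivotal' {A : Set (Set α)} (hA : MeasurableSet A) (a : α) :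
    MeasurableSet {S : Set α | IsPivotal A a S} := by
  have h1 : MeasurableSet {S : Set α | insert a S ∈ A} := measurable_insert' a hA
  have h2 : MeasurableSet {S : Set α | S \ {a} ∈ A} := measurable_sdiff_singleton' a hA
  have h : {S : Set α | IsPivotal A a S} = ({S | insert a S ∈ A} ∩ {S | S \ {a} ∈ A}ᶜ) ∪
      ({S | S \ {a} ∈ A} ∩ {S | insert a S ∈ A}ᶜ) := by
    ext S
    simp only [IsPivotal, Xor, Set.mem_setOf_eq, Set.mem_union, Set.mem_inter_iff,
      Set.mem_compl_iff]
  rw [h]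
  exact (h1.inter h2.compl).union (h2.inter h1.compl)

/-- Pivotality of `e` does not see the state of `e`: configurations agreeing off `e` agree on
`{e pivotal}`. -/
private theorem isPivotal_congr_off (A : Set (Set α)) {e : α} {ω ω' : Set α}
    (h : ∀ x, x ≠ e → (x ∈ ω ↔ x ∈ ω')) : IsPivotal A e ω ↔ IsPivotal A e ω' := by
  have h1 : insert e ω = insert e ω' := by
    ext x
    by_cases hx : x = e
    · subst hx; simp
    · simp [hx, h x hx]
  have h2 : ω \ {e} = ω' \ {e} := by
    ext x
    by_cases hx : x = e
    · subst hx; simp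
    · simp [hx, h x hx]
  unfold IsPivotal
  rw [h1, h2]

/-- **On `{e pivotal}` an increasing event holds iff `e` is open**:
`𝟙{e piv}(ω) (1 − 2·𝟙_A(ω)) = (1 − 2·𝟙{e ∈ ω}) 𝟙{e piv}(ω)`. -/
private theorem pivotal_mul_sign_eq {A : Set (Set α)} (hA : IsUpperSet A) (e : α) (ω : Set α) :
    (if IsPivotal A e ω then (1 : ℝ) else 0) * (if ω ∈ A then (-1 : ℝ) else 1) =
      (if e ∈ ω then (-1 : ℝ) else 1) * (if IsPivotal A e ω then (1 : ℝ) else 0) := by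
  by_cases hp : IsPivotal A e ω
  · have key : ω ∈ A ↔ e ∈ ω := by
      constructor
      · intro hω
        by_contra he
        exact ((Russo.isPivotal_iff_of_notMem hA he).1 hp).2 hω
      · intro he
        have h := hp
        unfold IsPivotal at h
        rw [Set.insert_eq_of_mem he] at h
        rcases h with ⟨h1, -⟩ | ⟨h1, h2⟩
        · exact h1
        · exact absurd (hA Set.sdiff_subset h1) h2
    by_cases he : e ∈ ω
    · rw [if_pos hp, if_pos (key.2 he), if_pos he, one_mul, mul_one]
    · rw [if_pos hp, if_neg (fun h => he (key.1 h)), if_neg he]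
  · rw [if_neg hp, zero_mul, mul_zero]

/-- `∫ (1 − 2·𝟙{f ∈ ω}) 𝟙{e piv}(ω) dν = ν{e piv} − 2 ν({e piv} ∩ {f open})`. -/
private theorem integral_sign_mul_pivotal (ν : Measure (Set α)) [IsFiniteMeasure ν]
    {A : Set (Set α)} (hA : MeasurableSet A) (e f : α) :
    ∫ ω, (if f ∈ ω then (-1 : ℝ) else 1) * (if IsPivotal A e ω then (1 : ℝ) else 0) ∂ν =
      ν.real {ω | IsPivotal A e ω} - 2 * ν.real ({ω | IsPivotal A e ω} ∩ {ω | f ∈ ω}) := by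
  have hG := measurableSet_isPivotal' hA e
  have hGF := hG.inter (measurableSet_mem f)
  have hpt : (fun ω : Set α =>
      (if f ∈ ω then (-1 : ℝ) else 1) * (if IsPivotal A e ω then (1 : ℝ) else 0)) =
      fun ω => {ω | IsPivotal A e ω}.indicator 1 ω -
        2 * ({ω | IsPivotal A e ω} ∩ {ω | f ∈ ω}).indicator 1 ω := by
    funext ω
    simp only [Set.indicator_apply, Set.mem_setOf_eq, Set.mem_inter_iff, Pi.one_apply]
    by_cases hp : IsPivotal A e ω <;> by_cases hf : f ∈ ω <;> norm_num [hp, hf]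
  have hi1 : Integrable ({ω | IsPivotal A e ω}.indicator (1 : Set α → ℝ)) ν :=
    (integrable_const (1 : ℝ)).indicator hG
  have hi2 : Integrable (fun ω => 2 * ({ω | IsPivotal A e ω} ∩ {ω | f ∈ ω}).indicator
      (1 : Set α → ℝ) ω) ν :=
    ((integrable_const (1 : ℝ)).indicator hGF).const_mul 2
  rw [hpt, integral_sub hi1 hi2, integral_const_mul, integral_indicator_one hG,
    integral_indicator_one hGF]

end SetSpace

/-! ## §3 The balance through a coding of `M_t` by the coin space -/

/-- **Heat-flow balance through a coding.** Let `μ = prodBernoulli P` on the coin space and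
`φ` a measurable coding of bond configurations; let `e` (the pivotal edge), `f` (the other
edge of the corner) and a coordinate `i` (the splitting bit) be such that, through `φ`,
`{e pivotal}` and `{f open}` do not depend on `i` while `{e open} = {f open} XOR (i ∈ S)`.
Then `E[𝟙{e piv}(1 − 2·𝟙_A)] = (1 − 2 P_i) E[(1 − 2·𝟙{f open}) 𝟙{e piv}]` under `μ ∘ φ⁻¹`. -/
private theorem balance_of_coding {P : Site 2 × Fin 2 → unitInterval}
    {φ : Set (Site 2 × Fin 2) → BondConfig (Site 2)} (hφ : Measurable φ)
    {A : Set (BondConfig (Site 2))} (hAm : MeasurableSet A) (hAu : IsUpperSet A)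
    {e f : Sym2 (Site 2)} (i : Site 2 × Fin 2)
    (hG : DeterminedBy (φ ⁻¹' {ω | IsPivotal A e ω}) ({i}ᶜ : Set (Site 2 × Fin 2)))
    (hC : DeterminedBy (φ ⁻¹' {ω | f ∈ ω}) ({i}ᶜ : Set (Site 2 × Fin 2)))
    (hN : φ ⁻¹' {ω | e ∈ ω} = {S | S ∈ φ ⁻¹' {ω | f ∈ ω} ↔ i ∉ S}) :
    ∫ ω, (if IsPivotal A e ω then (1 : ℝ) else 0) * (if ω ∈ A then (-1 : ℝ) else 1)
        ∂((prodBernoulli P).map φ) =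
      (1 - 2 * (P i : ℝ)) * ∫ ω, (if f ∈ ω then (-1 : ℝ) else 1) *
        (if IsPivotal A e ω then (1 : ℝ) else 0) ∂((prodBernoulli P).map φ) := by
  haveI : IsProbabilityMeasure ((prodBernoulli P).map φ) :=
    Measure.isProbabilityMeasure_map hφ.aemeasurable
  have hpt : (fun ω => (if IsPivotal A e ω then (1 : ℝ) else 0) * (if ω ∈ A then (-1 : ℝ) else 1)) =
      fun ω => (if e ∈ ω then (-1 : ℝ) else 1) * (if IsPivotal A e ω then (1 : ℝ) else 0) :=
    funext fun ω => pivotal_mul_sign_eq hAu e ω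
  have hGm : MeasurableSet {ω | IsPivotal A e ω} := measurableSet_isPivotal' hAm e
  rw [hpt, integral_sign_mul_pivotal _ hAm e e, integral_sign_mul_pivotal _ hAm e f,
    map_measureReal_apply hφ hGm, map_measureReal_apply hφ (hGm.inter (measurableSet_mem e)),
    map_measureReal_apply hφ (hGm.inter (measurableSet_mem f)), Set.preimage_inter,
    Set.preimage_inter, hN]
  exact balance_abstract P i hG hC (hφ hGm) (hφ (measurableSet_mem f))

/-- Coin sets agreeing on `{i}ᶜ` agree off `i`. -/
private theorem forall_iff_of_inter_compl_eq {S S' : Set (Site 2 × Fin 2)} {i : Site 2 × Fin 2}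
    (h : S ∩ {i}ᶜ = S' ∩ {i}ᶜ) : ∀ k, k ≠ i → (k ∈ S ↔ k ∈ S') := by
  intro k hk
  have := Set.ext_iff.1 h k
  simpa only [Set.mem_inter_iff, Set.mem_compl_iff, Set.mem_singleton_iff, hk,
    not_false_eq_true, and_true] using this

/-- The coin event `{S | (v,0) ∈ S}` does not depend on the splitting bit `(v,1)`. -/
private theorem determinedBy_coin (v : Site 2) :
    DeterminedBy {S : Set (Site 2 × Fin 2) | (v, (0 : Fin 2)) ∈ S}
      ({(v, (1 : Fin 2))}ᶜ : Set (Site 2 × Fin 2)) := by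
  refine (determinedBy_setOf_mem' (v, (0 : Fin 2))).mono fun k hk => ?_
  rw [Set.mem_singleton_iff] at hk
  subst hk
  simp

/-! ### §3.1 The north half: the coding `cornerConfig` -/

/-- Coin sets agreeing off the splitting bit `(v,1)` have corner configurations agreeing off
the north edge of `v`. -/
private theorem mem_cornerConfig_congr_off {S S' : Set (Site 2 × Fin 2)} {v : Site 2}
    (h : ∀ i, i ≠ (v, (1 : Fin 2)) → (i ∈ S ↔ i ∈ S')) {e : Sym2 (Site 2)}
    (he : e ≠ northEdge v) : e ∈ cornerConfig S ↔ e ∈ cornerConfig S' := by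
  simp only [mem_cornerConfig_iff]
  refine exists_congr fun w => ?_
  have h0 : (w, (0 : Fin 2)) ∈ S ↔ (w, (0 : Fin 2)) ∈ S' := h _ (by simp)
  by_cases hw : w = v
  · have hN : e ≠ s(w, w + ![0, 1]) := by rw [hw]; exact he
    simp only [hN, false_and, or_false, h0]
  · have h1 : (w, (1 : Fin 2)) ∈ S ↔ (w, (1 : Fin 2)) ∈ S' := h _ (by simp [hw])
    rw [h0, h1]

/-- Through `cornerConfig`, pivotality of the north edge of `v` does not depend on the
splitting bit of `v`. -/
private theorem determinedBy_pivotal_north (A : Set (BondConfig (Site 2))) (v : Site 2) :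
    DeterminedBy (cornerConfig ⁻¹' {ω | IsPivotal A (northEdge v) ω})
      ({(v, (1 : Fin 2))}ᶜ : Set (Site 2 × Fin 2)) := by
  rw [determinedBy_iff]
  intro S S' hSS'
  simp only [Set.mem_preimage, Set.mem_setOf_eq]
  exact isPivotal_congr_off A fun e he =>
    mem_cornerConfig_congr_off (forall_iff_of_inter_compl_eq hSS') he

/-- Through `cornerConfig`, `{E_v open} = {c_v = 1}`. -/
private theorem preimage_east_cornerConfig (v : Site 2) :
    cornerConfig ⁻¹' {ω | eastEdge v ∈ ω} = {S | (v, (0 : Fin 2)) ∈ S} := by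
  ext S
  simp only [Set.mem_preimage, Set.mem_setOf_eq, eastEdge, east_mem_cornerConfig_iff]

/-- Through `cornerConfig`, `{N_v open} = {E_v open} XOR {d_v = 1}`. -/
private theorem preimage_north_cornerConfig (v : Site 2) :
    cornerConfig ⁻¹' {ω | northEdge v ∈ ω} =
      {S | S ∈ cornerConfig ⁻¹' {ω | eastEdge v ∈ ω} ↔ (v, (1 : Fin 2)) ∉ S} := by
  ext S
  simp only [Set.mem_preimage, Set.mem_setOf_eq, northEdge, eastEdge, north_mem_cornerConfig_iff,
    east_mem_cornerConfig_iff]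

/-! ### §3.2 The east half: the transposed coding `cornerConfig ∘ blockMap transposeBit` -/

/-- Membership in the transposed corner configuration: the east edge of `w` is open iff the
coin and the splitting bit of `w` disagree, the north edge of `w` iff the coin shows `1`. -/
private theorem mem_cornerConfigT_iff (S : Set (Site 2 × Fin 2)) (e : Sym2 (Site 2)) :
    e ∈ cornerConfig (blockMap transposeBit S) ↔ ∃ w : Site 2,
      (e = s(w, w + ![1, 0]) ∧ ((w, (0 : Fin 2)) ∈ S ↔ (w, (1 : Fin 2)) ∉ S)) ∨
        (e = s(w, w + ![0, 1]) ∧ (w, (0 : Fin 2)) ∈ S) := by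
  rw [mem_cornerConfig_iff]
  refine exists_congr fun w => ?_
  simp only [mem_blockMap_iff, transposeBit, Fin.isValue, ↓reduceIte, one_ne_zero]
  tauto

/-- In the transposed coding the east edge of `v` is open iff `c_v ≠ d_v`. -/
private theorem east_mem_cornerConfigT_iff (S : Set (Site 2 × Fin 2)) (v : Site 2) :
    eastEdge v ∈ cornerConfig (blockMap transposeBit S) ↔
      ((v, (0 : Fin 2)) ∈ S ↔ (v, (1 : Fin 2)) ∉ S) := by
  rw [eastEdge, east_mem_cornerConfig_iff, mem_blockMap_iff]
  simp [transposeBit]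

/-- In the transposed coding the north edge of `v` is open iff the coin `c_v = 1`. -/
private theorem north_mem_cornerConfigT_iff (S : Set (Site 2 × Fin 2)) (v : Site 2) :
    northEdge v ∈ cornerConfig (blockMap transposeBit S) ↔ (v, (0 : Fin 2)) ∈ S := by
  rw [northEdge, north_mem_cornerConfig_iff, mem_blockMap_iff, mem_blockMap_iff]
  simp only [transposeBit, Fin.isValue, ↓reduceIte, one_ne_zero]
  tauto

/-- The transposed coding is measurable. -/
private theorem measurable_cornerConfigT :
    Measurable
      (cornerConfig ∘ blockMap transposeBit : Set (Site 2 × Fin 2) → BondConfig (Site 2)) :=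
  measurable_cornerConfig.comp (measurable_blockMap _)

/-- **`M_b` through the transposed coding**: `M_b = (prodBernoulli (cornerParam (projIcc b))).map
(cornerConfig ∘ Ψ)`, since `Ψ = blockMap transposeBit` preserves `prodBernoulli (cornerParam ·)`. -/
private theorem map_cornerConfigT_eq (b : ℝ) :
    M b = (prodBernoulli (cornerParam (Set.projIcc (0 : ℝ) 1 zero_le_one b))).map
      (cornerConfig ∘ blockMap transposeBit) := by
  rw [← Measure.map_map measurable_cornerConfig (measurable_blockMap _),
    prodBernoulli_cornerParam_map_blockMap _ transposeBit_involutive transposeBit_one]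
  rfl

/-- Coin sets agreeing off the splitting bit `(v,1)` have transposed corner configurations
agreeing off the east edge of `v`. -/
private theorem mem_cornerConfigT_congr_off {S S' : Set (Site 2 × Fin 2)} {v : Site 2}
    (h : ∀ i, i ≠ (v, (1 : Fin 2)) → (i ∈ S ↔ i ∈ S')) {e : Sym2 (Site 2)}
    (he : e ≠ eastEdge v) :
    e ∈ cornerConfig (blockMap transposeBit S) ↔ e ∈ cornerConfig (blockMap transposeBit S') := by
  rw [mem_cornerConfigT_iff, mem_cornerConfigT_iff]
  refine exists_congr fun w => ?_
  have h0 : (w, (0 : Fin 2)) ∈ S ↔ (w, (0 : Fin 2)) ∈ S' := h _ (by simp)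
  by_cases hw : w = v
  · have hE : e ≠ s(w, w + ![1, 0]) := by rw [hw]; exact he
    simp only [hE, false_and, false_or, h0]
  · have h1 : (w, (1 : Fin 2)) ∈ S ↔ (w, (1 : Fin 2)) ∈ S' := h _ (by simp [hw])
    rw [h0, h1]

/-- Through the transposed coding, pivotality of the east edge of `v` does not depend on the
splitting bit of `v`. -/
private theorem determinedBy_pivotal_eastT (A : Set (BondConfig (Site 2))) (v : Site 2) :
    DeterminedBy ((cornerConfig ∘ blockMap transposeBit) ⁻¹' {ω | IsPivotal A (eastEdge v) ω})
      ({(v, (1 : Fin 2))}ᶜ : Set (Site 2 × Fin 2)) := by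
  rw [determinedBy_iff]
  intro S S' hSS'
  simp only [Set.mem_preimage, Set.mem_setOf_eq, Function.comp_apply]
  exact isPivotal_congr_off A fun e he =>
    mem_cornerConfigT_congr_off (forall_iff_of_inter_compl_eq hSS') he

/-- Through the transposed coding, `{N_v open} = {c_v = 1}`. -/
private theorem preimage_north_cornerConfigT (v : Site 2) :
    (cornerConfig ∘ blockMap transposeBit) ⁻¹' {ω | northEdge v ∈ ω} =
      {S | (v, (0 : Fin 2)) ∈ S} := by
  ext S
  simp only [Set.mem_preimage, Set.mem_setOf_eq, Function.comp_apply, north_mem_cornerConfigT_iff]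

/-- Through the transposed coding, `{E_v open} = {N_v open} XOR {d_v = 1}`. -/
private theorem preimage_east_cornerConfigT (v : Site 2) :
    (cornerConfig ∘ blockMap transposeBit) ⁻¹' {ω | eastEdge v ∈ ω} =
      {S | S ∈ (cornerConfig ∘ blockMap transposeBit) ⁻¹' {ω | northEdge v ∈ ω} ↔
        (v, (1 : Fin 2)) ∉ S} := by
  ext S
  simp only [Set.mem_preimage, Set.mem_setOf_eq, Function.comp_apply, north_mem_cornerConfigT_iff,
    east_mem_cornerConfigT_iff]

/-! ## §4 The sub-goal -/

/-- SUB-GOAL (HF) of line `Sketch`: **the one-corner heat-flow balances**. For every vertex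
`v`, every `δ > 0` and every `t ∈ (0,1)`, with `A = crossEvent R δ`,
`E_t[𝟙{N_v piv}(1 − 2·𝟙_A)] = (1 − t) E_t[(1 − 2c_v) 𝟙{N_v piv}]` and
`E_t[𝟙{E_v piv}(1 − 2·𝟙_A)] = (1 − t) E_t[(1 − 2n_v) 𝟙{E_v piv}]`. -/
theorem stub_heatFlowBalance : HeatFlowBalance := by
  intro R δ _ v t ht
  set t' : unitInterval := Set.projIcc (0 : ℝ) 1 zero_le_one t with ht'
  have htt' : (t' : ℝ) = t := by
    rw [ht', Set.projIcc_of_mem zero_le_one (Set.Ioo_subset_Icc_self ht)]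
  have hcoef : 1 - 2 * ((cornerParam t' (v, 1) : unitInterval) : ℝ) = 1 - t := by
    rw [coe_cornerParam_apply_one, htt']
    ring
  have hAm := measurableSet_crossEvent R δ
  have hAu := isUpperSet_crossEvent R δ
  constructor
  · -- the north half, through the coding `cornerConfig`
    have hM : M t = (prodBernoulli (cornerParam t')).map cornerConfig := rfl
    rw [hM, ← hcoef]
    unfold russoIntegrand
    exact balance_of_coding measurable_cornerConfig hAm hAu (v, (1 : Fin 2))
      (determinedBy_pivotal_north _ v)
      (by rw [preimage_east_cornerConfig]; exact determinedBy_coin v)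
      (preimage_north_cornerConfig v)
  · -- the east half, through the transposed coding `cornerConfig ∘ blockMap transposeBit`
    rw [map_cornerConfigT_eq t, ← hcoef]
    unfold russoIntegrandEast
    exact balance_of_coding measurable_cornerConfigT hAm hAu (v, (1 : Fin 2))
      (determinedBy_pivotal_eastT _ v)
      (by rw [preimage_north_cornerConfigT]; exact determinedBy_coin v)
      (preimage_east_cornerConfigT v)

end Summit.CriticalPhenomena.CardyFormulaZ2.Cruxes.UniformMarginality.HeatFlow
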